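import Mathlib.Analysis.SpecialFunctions.Complex.Log
import Literature.Probability.RandomPlanarGeometry.PolygonalDomains
import Literature.Topology.PlaneTopology.EilenbergCriterion
import HarnessLib

/-!
# Inside a Jordan curve from the winding number; the winding number of a polygon

Two tools for deciding that a point lies INSIDE a Jordan curve given as a loop (the hard
direction of ray casting), used to verify `0 ∈ D^R` for the grid approximations of the UST Peano
curve ([LSW04] §4.3, `USTPeanoSetting.IsApproximation`):

* `JordanDomain.mem_carrier_of_wind_ne_zero` — if the boundary loop of a Jordan domain `D` winds
  around `z ∉ ∂D` (`wind (D.boundary - z) ≠ 0`, the winding number of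
  `Literature/Topology/PlaneTopology/WindingNumber.lean`), then `z ∈ D`. (Points of the outside
  are in the complementary component of a far-away point `w`; by the Eilenberg–Janiszewski lemma
  `(· - z)/(· - w)` has a logarithm on the curve, so `wind (γ - z) = wind (γ - w)`, and the latter
  vanishes by Rouché against the constant loop `-w`.)
* `one_le_wind_polygonLoop_sub` — **the winding number of a closed polygon all of whose edges
  are seen counterclockwise from `z`** (`cross (vₖ - z) (vₖ₊₁ - z) > 0` for every cyclic edge) is
  at least `1`: an explicit continuous logarithm along the polygon is `Λₖ + Log((1 - s) + s wₖ)`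
  on the `k`-th edge, `wₖ = (vₖ₊₁ - z)/(vₖ - z)` (upper half-plane), `Λₖ₊₁ = Λₖ + Log wₖ`, whose
  total increment is `i ∑ₖ arg wₖ` with every `arg wₖ ∈ (0, π)`.
* `mem_polygonDomain_of_cross_pos` — hence such a `z` lies in the polygonal Jordan domain.

## Mathlib / tree
`Complex.log`, `Complex.arg`, `Complex.slitPlane`, `continuousAt_clog`, `Complex.arg_nonneg_iff`,
`Complex.arg_eq_zero_iff`, `LocallyFinite.continuousOn_iUnion`; from the tree's plane topology:
`wind`, `wind_spec`, `wind_div`, `wind_const`, `wind_eq_of_norm_sub_lt`,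
`wind_comp_eq_zero_of_hasLogOn`, `hasLogOn_div_sub_of_mem_connectedComponentIn`.
-/

noncomputable section

open Set Function Complex
open Literature.Topology.PlaneTopology

namespace Literature.Probability.RandomPlanarGeometry

/-! ### Inside from a nonzero winding number -/

namespace JordanDomain

variable (D : JordanDomain)

/-- The boundary loop of a Jordan domain is bounded: `‖D.boundary t‖ ≤ M` for some `M`. [folklore] -/
theorem exists_norm_boundary_le : ∃ M : ℝ, 0 ≤ M ∧ ∀ t, ‖D.boundary t‖ ≤ M := by
  have hc : IsCompact (D.boundary '' Icc 0 1) := isCompact_Icc.image D.continuous_boundary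
  obtain ⟨M, hM⟩ := hc.isBounded.exists_norm_le
  refine ⟨max M 0, le_max_right _ _, fun t ↦ ?_⟩
  have ht : D.boundary t = D.boundary (Int.fract t) := by
    rw [Int.fract, sub_eq_add_neg, ← Int.cast_neg]
    exact (D.periodic_boundary.int_mul (-⌊t⌋) t).symm.trans (by simp)
  rw [ht]
  exact (hM _ ⟨Int.fract t, ⟨Int.fract_nonneg t, (Int.fract_lt_one t).le⟩, rfl⟩).trans
    (le_max_left _ _)

/-- **Inside from the winding number**: if the boundary loop of the Jordan domain `D` has nonzero
winding number about a point `z` off the boundary, then `z ∈ D`. [folklore] -/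
theorem mem_carrier_of_wind_ne_zero {z : ℂ} (hz : z ∉ frontier D.carrier)
    (hw : wind (fun t ↦ D.boundary t - z) ≠ 0) : z ∈ D.carrier := by
  by_contra hzD
  obtain ⟨V, -, hVc, -, hunion, -, hVb⟩ :=
    D.exists_outside Literature.Topology.PlaneTopology.JordanCurveTheorem_holds
  have hzV : z ∈ V := by
    have : z ∈ D.carrier ∪ V := by rw [hunion]; exact hz
    exact this.resolve_left hzD
  obtain ⟨M, hM0, hM⟩ := D.exists_norm_boundary_le
  have hper : D.boundary 1 = D.boundary 0 := by simpa using D.periodic_boundary 0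
  -- a far-away point of the (unbounded) outside
  obtain ⟨w, hwV, hwM⟩ : ∃ w ∈ V, M < ‖w‖ := by
    by_contra! h
    exact hVb ((Metric.isBounded_closedBall (x := (0 : ℂ)) (r := M)).subset fun w hw ↦ by
      simpa using h w hw)
  have hVC : V ⊆ (frontier D.carrier)ᶜ := hunion ▸ subset_union_right
  have hwC : w ∉ frontier D.carrier := hVC hwV
  have hw0 : w ≠ 0 := by
    rintro rfl
    simp at hwM
    exact not_lt.2 hM0 hwM
  -- `w` is in the complementary component of `z`
  have hwz : w ∈ connectedComponentIn (frontier D.carrier)ᶜ z :=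
    hVc.isPreconnected.subset_connectedComponentIn hzV hVC hwV
  have hlog := hasLogOn_div_sub_of_mem_connectedComponentIn isClosed_frontier hwz
  -- the three loops
  have hf : IsNonvanishingLoop fun t ↦ D.boundary t - z :=
    ⟨(D.continuous_boundary.continuousOn).sub continuousOn_const,
      fun t _ h ↦ hz (sub_eq_zero.1 h ▸ D.boundary_mem_frontier t),
      by simp only [hper]⟩
  have hg : IsNonvanishingLoop fun t ↦ D.boundary t - w :=
    ⟨(D.continuous_boundary.continuousOn).sub continuousOn_const,
      fun t _ h ↦ hwC (sub_eq_zero.1 h ▸ D.boundary_mem_frontier t),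
      by simp only [hper]⟩
  have h1 : wind ((fun x ↦ (x - z) / (x - w)) ∘ D.boundary) = 0 :=
    wind_comp_eq_zero_of_hasLogOn hlog D.continuous_boundary.continuousOn
      (fun t _ ↦ D.boundary_mem_frontier t) hper.symm
  have h2 : wind (fun t ↦ D.boundary t - z) = wind (fun t ↦ D.boundary t - w) := by
    have := wind_div hf hg
    change wind (fun t ↦ (D.boundary t - z) / (D.boundary t - w)) = _ at this
    have h1' : wind (fun t ↦ (D.boundary t - z) / (D.boundary t - w)) = 0 := h1
    omega
  have h3 : wind (fun t ↦ D.boundary t - w) = 0 := by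
    rw [← wind_const (-w)]
    refine wind_eq_of_norm_sub_lt hg.continuousOn hg.eq_endpoints (IsNonvanishingLoop.const
      (neg_ne_zero.2 hw0)) fun t _ ↦ ?_
    simpa using (hM t).trans_lt hwM
  exact hw (h2.trans h3)

end JordanDomain

/-! ### The winding number of a polygon seen counterclockwise -/

/-- The planar **cross product** `u × v = re u · im v - im u · re v` (`= im (conj u · v)`); it is
positive iff `v` points strictly to the left of `u`, i.e. the edge from `u` to `v` is seen
counterclockwise from the origin. [folklore] -/
def cross (u v : ℂ) : ℝ := u.re * v.im - u.im * v.re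

/-- `cross u v = im (v / u) · ‖u‖²`: the imaginary part of the ratio has the sign of the cross
product. [folklore] -/
theorem im_div_eq_cross_div (u v : ℂ) : (v / u).im = cross u v / Complex.normSq u := by
  rw [Complex.div_im, cross]
  ring

section Polygon

variable {l : List ℂ} {z : ℂ}

/-- With every edge seen counterclockwise from `z`, no vertex is `z`. [folklore] -/
theorem sub_ne_zero_of_cross_pos (hl : 0 < l.length)
    (h : ∀ (k : ℕ) (hk : k < l.length),
      0 < cross (l[k] - z) (l[(k + 1) % l.length]'(Nat.mod_lt _ hl) - z))
    (k : ℕ) (hk : k < l.length) : l[k] - z ≠ 0 := by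
  intro h0
  have := h k hk
  rw [h0, cross] at this
  simp at this

/-- The ratios `wₖ = (vₖ₊₁ - z)/(vₖ - z)` lie in the open upper half-plane. [folklore] -/
theorem im_ratio_pos (hl : 0 < l.length)
    (h : ∀ (k : ℕ) (hk : k < l.length),
      0 < cross (l[k] - z) (l[(k + 1) % l.length]'(Nat.mod_lt _ hl) - z))
    (k : ℕ) (hk : k < l.length) :
    0 < ((l[(k + 1) % l.length]'(Nat.mod_lt _ hl) - z) / (l[k] - z)).im := by
  rw [im_div_eq_cross_div]
  exact div_pos (h k hk) (Complex.normSq_pos.2 (sub_ne_zero_of_cross_pos hl h k hk))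

/-- The accumulated logarithms `Λ₀ = Log (v₀ - z)`, `Λₖ₊₁ = Λₖ + Log wₖ` along the polygon.
[folklore] -/
def vertexLog (l : List ℂ) (z : ℂ) (hl : 0 < l.length) : ℕ → ℂ
  | 0 => Complex.log (l[0] - z)
  | k + 1 => vertexLog l z hl k +
      Complex.log ((l[(k + 1) % l.length]'(Nat.mod_lt _ hl) - z) / (l[k % l.length]'(Nat.mod_lt _ hl) - z))

/-- `exp Λₖ = v_{k % N} - z`. [folklore] -/
theorem exp_vertexLog (hl : 0 < l.length)
    (h : ∀ (k : ℕ) (hk : k < l.length),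
      0 < cross (l[k] - z) (l[(k + 1) % l.length]'(Nat.mod_lt _ hl) - z)) :
    ∀ k : ℕ, Complex.exp (vertexLog l z hl k) = l[k % l.length]'(Nat.mod_lt _ hl) - z
  | 0 => by
    have e : l[0 % l.length]'(Nat.mod_lt _ hl) = l[0] := getElem_congr_idx (Nat.zero_mod _)
    rw [e, vertexLog, Complex.exp_log (sub_ne_zero_of_cross_pos hl h 0 hl)]
  | k + 1 => by
    have hk : k % l.length < l.length := Nat.mod_lt _ hl
    have hne := sub_ne_zero_of_cross_pos hl h (k % l.length) hk
    have hne' : l[(k + 1) % l.length]'(Nat.mod_lt _ hl) - z ≠ 0 :=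
      sub_ne_zero_of_cross_pos hl h ((k + 1) % l.length) (Nat.mod_lt _ hl)
    rw [vertexLog, Complex.exp_add, exp_vertexLog hl h k, Complex.exp_log (div_ne_zero hne' hne),
      mul_div_cancel₀ _ hne]

/-- The ratio appearing in `vertexLog (k+1)` is the edge ratio at the vertex `k % N`. [folklore] -/
theorem ratio_mod_eq (hl : 0 < l.length) (k : ℕ) :
    (l[(k + 1) % l.length]'(Nat.mod_lt _ hl) - z) / (l[k % l.length]'(Nat.mod_lt _ hl) - z) =
      (l[(k % l.length + 1) % l.length]'(Nat.mod_lt _ hl) - z) /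
        (l[k % l.length]'(Nat.mod_lt _ hl) - z) := by
  have e : l[(k % l.length + 1) % l.length]'(Nat.mod_lt _ hl) =
      l[(k + 1) % l.length]'(Nat.mod_lt _ hl) := getElem_congr_idx (Nat.mod_add_mod _ _ _)
  rw [e]

/-- The imaginary part of `Λ_N - Λ₀` is `∑ₖ arg wₖ`, a sum of numbers in `(0, π]`; in particular
it is positive. We only record: `im (Λₖ - Λ₀) ≥ 0` with strict inequality for `k ≥ 1`. [folklore] -/
theorem im_vertexLog_sub_pos (hl : 0 < l.length)
    (h : ∀ (k : ℕ) (hk : k < l.length),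
      0 < cross (l[k] - z) (l[(k + 1) % l.length]'(Nat.mod_lt _ hl) - z)) :
    ∀ k : ℕ, 1 ≤ k → 0 < (vertexLog l z hl k - vertexLog l z hl 0).im
  | 0, h0 => absurd h0 (by omega)
  | k + 1, _ => by
    have harg : 0 < ((l[(k + 1) % l.length]'(Nat.mod_lt _ hl) - z) /
        (l[k % l.length]'(Nat.mod_lt _ hl) - z)).arg := by
      rw [ratio_mod_eq hl k]
      have him := im_ratio_pos hl h (k % l.length) (Nat.mod_lt _ hl)
      rcases (Complex.arg_nonneg_iff.2 him.le).lt_or_eq with hpos | h0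
      · exact hpos
      · exfalso
        have := Complex.arg_eq_zero_iff.1 h0.symm
        exact him.ne' this.2
    have hdef : vertexLog l z hl (k + 1) = vertexLog l z hl k +
        Complex.log ((l[(k + 1) % l.length]'(Nat.mod_lt _ hl) - z) /
          (l[k % l.length]'(Nat.mod_lt _ hl) - z)) := rfl
    rw [hdef, add_sub_right_comm, Complex.add_im, Complex.log_im]
    rcases Nat.eq_zero_or_pos k with rfl | hk
    · rw [sub_self, Complex.zero_im, zero_add]
      exact harg
    · exact add_pos (im_vertexLog_sub_pos hl h k hk) harg

/-- **A closed polygon seen counterclockwise from `z` winds at least once around `z`.** If every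
cyclic edge `[vₖ, vₖ₊₁]` of the closed polygon through `l` satisfies
`cross (vₖ - z) (vₖ₊₁ - z) > 0` (it is seen strictly counterclockwise from `z`), then
`wind (polygonLoop l - z) ≥ 1`. [folklore] -/
theorem one_le_wind_polygonLoop_sub (hl : 0 < l.length)
    (h : ∀ (k : ℕ) (hk : k < l.length),
      0 < cross (l[k] - z) (l[(k + 1) % l.length]'(Nat.mod_lt _ hl) - z)) :
    1 ≤ wind (fun t ↦ polygonLoop l t - z) := by
  have hl' : l ≠ [] := List.ne_nil_of_length_pos hl
  set N := l.length with hN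
  have hNr : (0 : ℝ) < N := by exact_mod_cast hl
  -- edge ratios and the interpolated points `q k s = (1 - s) + s • w k`
  set w : ℕ → ℂ := fun k ↦ (l[(k + 1) % N]'(Nat.mod_lt _ hl) - z) / (l[k % N]'(Nat.mod_lt _ hl) - z)
    with hw
  have hwim : ∀ k, 0 < (w k).im := fun k ↦ by
    simp only [hw]
    rw [ratio_mod_eq hl k]
    exact im_ratio_pos hl h _ (Nat.mod_lt _ hl)
  set q : ℕ → ℝ → ℂ := fun k s ↦ 1 - s + s * w k with hq
  have hq_slit : ∀ k, ∀ s ∈ Icc (0 : ℝ) 1, q k s ∈ Complex.slitPlane := fun k s hs ↦ by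
    rw [Complex.mem_slitPlane_iff]
    rcases hs.1.eq_or_lt with rfl | hs0
    · left; simp [hq]
    · right
      simp only [hq, Complex.add_im, Complex.sub_im, Complex.one_im, Complex.ofReal_im, sub_self,
        zero_add, Complex.mul_im, Complex.ofReal_re, Complex.ofReal_im, zero_mul, add_zero]
      exact (mul_pos hs0 (hwim k)).ne'
  -- the logarithm along the polygon
  set Λ := vertexLog l z hl with hΛ
  set piece : ℕ → ℝ → ℂ := fun k t ↦ Λ k + Complex.log (q k (N * t - k)) with hpiece
  set L : ℝ → ℂ := fun t ↦ piece ⌊(N : ℝ) * t⌋₊ t with hL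
  -- values at the knots agree: piece k ((k+1)/N) = Λ (k+1) = piece (k+1) ((k+1)/N)
  have hknot : ∀ k : ℕ, piece k ((k + 1 : ℕ) / N) = Λ (k + 1) := fun k ↦ by
    have h1 : (N : ℝ) * (((k + 1 : ℕ) : ℝ) / N) - k = 1 := by
      rw [mul_div_cancel₀ _ hNr.ne']; push_cast; ring
    have h2 : q k 1 = w k := by simp [hq]
    simp only [hpiece, h1, h2]
    rfl
  have hknot' : ∀ k : ℕ, piece k ((k : ℕ) / N) = Λ k := fun k ↦ by
    have h1 : (N : ℝ) * ((k : ℝ) / N) - k = 0 := by rw [mul_div_cancel₀ _ hNr.ne', sub_self]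
    have h2 : q k 0 = 1 := by simp [hq]
    simp only [hpiece, h1, h2, Complex.log_one, add_zero]
  -- from `t ∈ [k/N, (k+1)/N]`: `k ≤ N t ≤ k + 1`
  have hIcc : ∀ (k : ℕ) (t : ℝ), t ∈ Icc ((k : ℝ) / N) ((k + 1 : ℕ) / N) →
      (k : ℝ) ≤ N * t ∧ (N : ℝ) * t ≤ k + 1 := fun k t ht ↦ by
    constructor
    · have := ht.1; rw [div_le_iff₀ hNr] at this; linarith
    · have := ht.2; rw [le_div_iff₀ hNr] at this; push_cast at this; linarith
  -- `L` agrees with `piece k` on the closed `k`-th parameter interval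
  have hLeq : ∀ k : ℕ, EqOn L (piece k) (Icc ((k : ℝ) / N) ((k + 1 : ℕ) / N)) := by
    intro k t ht
    obtain ⟨h1, h2⟩ := hIcc k t ht
    simp only [hL]
    rcases h2.lt_or_eq with hlt | heq
    · rw [Nat.floor_eq_on_Ico k _ ⟨h1, hlt⟩]
    · have ht' : t = ((k + 1 : ℕ) : ℝ) / N := by
        rw [eq_div_iff hNr.ne']; push_cast; linarith
      have hfl : ⌊(N : ℝ) * t⌋₊ = k + 1 := by
        rw [heq]; exact_mod_cast Nat.floor_natCast (R := ℝ) (k + 1)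
      rw [hfl, ht', hknot' (k + 1), hknot k]
  -- continuity of each piece on its interval
  have hpc : ∀ k : ℕ, ContinuousOn (piece k) (Icc ((k : ℝ) / N) ((k + 1 : ℕ) / N)) := by
    intro k
    have hcq : Continuous fun t : ℝ ↦ q k (N * t - k) := by simp only [hq]; fun_prop
    intro t ht
    obtain ⟨h1, h2⟩ := hIcc k t ht
    have hs : (N : ℝ) * t - k ∈ Icc (0 : ℝ) 1 := ⟨by linarith, by linarith⟩
    have hc : ContinuousAt (fun t : ℝ ↦ Complex.log (q k (N * t - k))) t :=
      ContinuousAt.comp (g := Complex.log) (f := fun t : ℝ ↦ q k (N * t - k))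
        (continuousAt_clog (hq_slit k _ hs)) hcq.continuousAt
    have : ContinuousAt (piece k) t := by
      simp only [hpiece]
      exact continuousAt_const.add hc
    exact this.continuousWithinAt
  have hLc : ContinuousOn L (Icc 0 1) := by
    have hcov : Icc (0 : ℝ) 1 = ⋃ k : Fin N, Icc ((k : ℕ) / (N : ℝ)) (((k : ℕ) + 1 : ℕ) / N) := by
      apply Subset.antisymm
      · intro t ht
        have ht0 : 0 ≤ (N : ℝ) * t := mul_nonneg hNr.le ht.1
        rcases ht.2.lt_or_eq with hlt | rfl
        · have hk : ⌊(N : ℝ) * t⌋₊ < N := (Nat.floor_lt ht0).2 (by nlinarith)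
          refine mem_iUnion.2 ⟨⟨_, hk⟩, ?_, ?_⟩
          · rw [div_le_iff₀ hNr]
            have := Nat.floor_le ht0
            linarith
          · rw [le_div_iff₀ hNr]; push_cast
            have := Nat.lt_floor_add_one ((N : ℝ) * t); linarith
        · obtain ⟨n, hn⟩ : ∃ n, N = n + 1 := ⟨N - 1, by omega⟩
          refine mem_iUnion.2 ⟨⟨n, by omega⟩, ?_, ?_⟩
          · rw [div_le_iff₀ hNr, one_mul]; exact_mod_cast (by omega : n ≤ N)
          · rw [le_div_iff₀ hNr, one_mul]; exact_mod_cast (by omega : N ≤ n + 1)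
      · intro t ht
        obtain ⟨k, hk⟩ := mem_iUnion.1 ht
        refine ⟨le_trans (by positivity) hk.1, hk.2.trans ?_⟩
        rw [div_le_one hNr]; exact_mod_cast k.2
    rw [hcov]
    exact LocallyFinite.continuousOn_iUnion (locallyFinite_of_finite _) (fun _ ↦ isClosed_Icc)
      fun k ↦ (hpc k).congr (hLeq k)
  -- the values of `L` at the endpoints
  have hL1 : L 1 = Λ N := by
    have : L 1 = piece N ((N : ℕ) / N) := by
      simp only [hL, mul_one, Nat.floor_natCast, div_self hNr.ne']
    rw [this, hknot' N]
  have hL0 : L 0 = Λ 0 := by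
    have : L 0 = piece 0 ((0 : ℕ) / N) := by
      simp only [hL, mul_zero, Nat.floor_zero, Nat.cast_zero, zero_div]
    rw [this, hknot' 0]
  -- `L` is a logarithm of the loop
  have hLexp : ∀ t ∈ Icc (0 : ℝ) 1, Complex.exp (L t) = polygonLoop l t - z := by
    intro t ht
    have ht0 : 0 ≤ (N : ℝ) * t := mul_nonneg hNr.le ht.1
    rcases ht.2.lt_or_eq with hlt | rfl
    · set k := ⌊(N : ℝ) * t⌋₊ with hk
      have hks : (k : ℝ) ≤ N * t := Nat.floor_le ht0
      have hsk : (N : ℝ) * t < k + 1 := Nat.lt_floor_add_one _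
      have hkN : k < N := (Nat.floor_lt ht0).2 (by nlinarith)
      have hs : (N : ℝ) * t - k ∈ Icc (0 : ℝ) 1 := ⟨by linarith, by linarith⟩
      have ht' : t = (k + ((N : ℝ) * t - k)) / N := by field_simp; ring
      have e1 : l[k % N]'(Nat.mod_lt _ hl) = l[k] := getElem_congr_idx (Nat.mod_eq_of_lt hkN)
      have hne := sub_ne_zero_of_cross_pos hl h k hkN
      have hval : L t = Λ k + Complex.log (q k (N * t - k)) := rfl
      rw [hval, Complex.exp_add, hΛ, exp_vertexLog hl h k,
        Complex.exp_log (Complex.slitPlane_ne_zero (hq_slit k _ hs)), e1]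
      conv_rhs => rw [ht', polygonLoop_apply_div hkN hs]
      rw [AffineMap.lineMap_apply_module', Complex.real_smul]
      simp only [hq, hw, e1]
      field_simp
      ring
    · -- `t = 1`
      rw [hL1, hΛ, exp_vertexLog hl h N]
      have hp : polygonLoop l 1 = l[0] := by
        have h0 := polygonLoop_vertex (l := l) (k := 0) hl
        rw [Nat.cast_zero, zero_div] at h0
        rw [← h0]
        simpa using periodic_polygonLoop l 0
      have e0 : l[N % N]'(Nat.mod_lt _ hl) = l[0] := getElem_congr_idx (Nat.mod_self _)
      rw [e0, hp]
  -- the loop closes up and the increment of `L` is `Λ_N - Λ_0`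
  have h01 : (fun t ↦ polygonLoop l t - z) 0 = (fun t ↦ polygonLoop l t - z) 1 := by
    have := periodic_polygonLoop l 0
    simp only [zero_add] at this
    simp only [this]
  have hspec := wind_spec hLc hLexp h01
  rw [hL1, hL0] at hspec
  -- imaginary parts: `im (Λ_N - Λ_0) = 2π · wind`, and the left side is positive
  have him := congrArg Complex.im hspec
  simp only [Complex.mul_im, Complex.intCast_re, Complex.intCast_im, zero_mul, add_zero,
    Complex.mul_re, Complex.re_ofNat, Complex.im_ofNat, Complex.ofReal_re, Complex.ofReal_im,
    Complex.I_re, Complex.I_im, mul_zero, sub_zero, mul_one] at him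
  have hpos := im_vertexLog_sub_pos hl h N hl
  rw [← hΛ] at hpos
  rw [him] at hpos
  have : (0 : ℝ) < wind (fun t ↦ polygonLoop l t - z) := by
    have h2 : (0 : ℝ) < 2 * Real.pi := by positivity
    nlinarith
  exact_mod_cast this

/-- **A point from which every edge is seen counterclockwise lies inside the polygon.** [folklore] -/
theorem mem_polygonDomain_of_cross_pos (hs : IsSimpleClosedPolygon l)
    (h : ∀ (k : ℕ) (hk : k < l.length),
      0 < cross (l[k] - z) (l[(k + 1) % l.length]'(Nat.mod_lt _ hs.pos) - z)) :
    z ∈ (polygonDomain l hs).carrier := by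
  refine JordanDomain.mem_carrier_of_wind_ne_zero _ ?_ ?_
  · -- `z` is not on the polygon: on the edge `k` the cross product with its endpoints vanishes
    rw [frontier_polygonDomain, mem_iUnion]
    rintro ⟨k, hk⟩
    rw [segment_eq_image_lineMap] at hk
    obtain ⟨θ, hθ, hz⟩ := hk
    have hc := h k k.2
    have e : l[(k : ℕ)] - z = -(θ • (l[((k : ℕ) + 1) % l.length]'(Nat.mod_lt _ hs.pos) - l[(k:ℕ)])) := by
      rw [← hz, AffineMap.lineMap_apply_module']; abel
    have e' : l[((k : ℕ) + 1) % l.length]'(Nat.mod_lt _ hs.pos) - z =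
        (1 - θ) • (l[((k : ℕ) + 1) % l.length]'(Nat.mod_lt _ hs.pos) - l[(k:ℕ)]) := by
      rw [← hz, AffineMap.lineMap_apply_module']; module
    rw [e, e', cross] at hc
    simp only [Complex.neg_re, Complex.neg_im, Complex.real_smul, Complex.mul_re, Complex.ofReal_re,
      Complex.ofReal_im, zero_mul, sub_zero, Complex.mul_im, add_zero] at hc
    nlinarith [hc]
  · have := one_le_wind_polygonLoop_sub hs.pos h
    change wind (fun t ↦ polygonLoop l t - z) ≠ 0
    omega

end Polygon

end Literature.Probability.RandomPlanarGeometry
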